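/-
# The blind configuration exists: B16's model instantiated with Wolff packing data

(rh-split-screw-bridge g13, cell rh-split; card `cards/SPLIT-screw-bridge.md` §18, barrier candidate
B16.)  Nothing in this file is a claim about `ζ` or about the truth of RH: it exhibits an abstract
configuration of "zero quadruples" `{1/2 ± σ_i ± iγ}` with positive REAL weights whose model screw
function passes the full one-lattice kernel test while `sup σ_i` is not attained.
-/
import Summits.RiemannHypothesis.RiemannHypothesis.Theorems.Splittings.ScrewLatticeWolffC
import Summits.RiemannHypothesis.RiemannHypothesis.Theorems.Splittings.ScrewLatticeWolffData
import Mathlib.Analysis.SpecialFunctions.Complex.Arg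
import Mathlib.Analysis.SpecialFunctions.Log.Basic
import HarnessLib

/-!
# `exists_blind_model` — the kernel form of barrier candidate B16

For every step `h > 0` and every `σ* > 0` there is a configuration (index type `ι`, weights
`m₁ m₂ : ι → ℝ`, exponents `κ₁ κ₂ : ι → ℂ`, read: the zero quadruples `{1/2 ± Re κ ± i Im κ}` with
multiplicity `m`) such that

* all weights are positive reals; all abscissae `Re κ₁ i = Re κ₂ i ∈ (0, σ*)`; all ordinates `> 14`;
  the ordinates are locally finite (`{i | Im κ i ≤ T}` finite for every `T`); `Σ_i (m₁/γ₁² + m₂/γ₂²) < ∞`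
  (the class condition `Σ m/|Im ρ|² < ∞`);
* `sup_i Re κ₁ i` is NOT attained (`∀ i ∃ j, Re κ₁ i < Re κ₁ j`) — so the configuration has "zeros"
  off every line `Re s = 1/2 + σ` that bounds it, no extremal abscissa, and no zero-free strip below its
  supremum;
* the model screw function `Ψ_Z = modelPsi m₁ m₂ κ₁ κ₂` satisfies on the lattice `hℕ`:
  `2A ≤ Ψ_Z(kh) ≤ 6A` (`k ≥ 1`, some `A > 0`) and the full positive-semidefiniteness `LPSD(h)`.

Proof: `ScrewLatticeWolffData.exists_wolffData` (R := e^{σ* h}) gives atoms `w` and areas `α`;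
aliases `N_i = N₀ + f(i)` along an injection `f : ι ↪ ℕ` make the ordinates `> 14`, `≥ 2σ*` and
locally finite; `ScrewLatticeWolff.exists_tuning` (re-proved here with its explicit solution to get the
bound `m_j/γ_j² ≤ 3·α_i`) tunes the weights; `ScrewLatticeWolff.modelPsi_latticePSD / _floor /
_ceiling` do the rest.
-/

set_option linter.dupNamespace false

noncomputable section

open Complex Set
open scoped ComplexConjugate Real

namespace Summit.RiemannHypothesis.RiemannHypothesis.Theorems.Splittings.ScrewLatticeWolffModel

open Summit.RiemannHypothesis.RiemannHypothesis.Theorems.Splittings.ScrewLatticeWolff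
open Summit.RiemannHypothesis.RiemannHypothesis.Theorems.Splittings.ScrewLatticeWolffData

/-! ## 1. Tuning with a bound -/

/-- `exists_tuning` with its explicit solution and the bound `m_j / γ_j² ≤ 3c` when `γ_j ≥ 2σ`. -/
theorem exists_tuning_bound {σ γ₁ γ₂ c : ℝ} (hσ : 0 < σ) (h₁ : 2 * σ ≤ γ₁) (h₂ : 2 * σ ≤ γ₂)
    (hc : 0 < c) :
    ∃ m₁ m₂ : ℝ, 0 < m₁ ∧ 0 < m₂ ∧
      (m₁ : ℂ) / ((σ : ℂ) + γ₁ * I) ^ 2 + (m₂ : ℂ) / (conj ((σ : ℂ) + γ₂ * I)) ^ 2 = -(c : ℂ) ∧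
      m₁ / γ₁ ^ 2 ≤ 3 * c ∧ m₂ / γ₂ ^ 2 ≤ 3 * c := by
  have hγ₁ : σ < γ₁ := by linarith
  have hγ₂ : σ < γ₂ := by linarith
  have hγ₁0 : 0 < γ₁ := hσ.trans hγ₁
  have hγ₂0 : 0 < γ₂ := hσ.trans hγ₂
  set n₁ : ℝ := σ ^ 2 + γ₁ ^ 2 with hn₁
  set n₂ : ℝ := σ ^ 2 + γ₂ ^ 2 with hn₂
  have hn₁0 : 0 < n₁ := by positivity
  have hn₂0 : 0 < n₂ := by positivity
  set D : ℝ := γ₂ * (γ₁ ^ 2 - σ ^ 2) + γ₁ * (γ₂ ^ 2 - σ ^ 2) with hD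
  have hg₁ : 0 < γ₁ ^ 2 - σ ^ 2 := by nlinarith
  have hg₂ : 0 < γ₂ ^ 2 - σ ^ 2 := by nlinarith
  have hD0 : 0 < D := by positivity
  refine ⟨c * γ₂ * n₁ ^ 2 / D, c * γ₁ * n₂ ^ 2 / D, by positivity, by positivity, ?_, ?_, ?_⟩
  · -- the tuning identity (same computation as `ScrewLatticeWolff.exists_tuning`)
    have hκ₁ : ((σ : ℂ) + γ₁ * I) ^ 2 ≠ 0 := by
      apply pow_ne_zero
      intro h0
      have := congrArg Complex.im h0
      simp at this
      linarith
    have hκ₂ : (conj ((σ : ℂ) + γ₂ * I)) ^ 2 ≠ 0 := by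
      apply pow_ne_zero
      intro h0
      have := congrArg Complex.im h0
      simp at this
      linarith
    rw [div_add_div _ _ hκ₁ hκ₂, div_eq_iff (mul_ne_zero hκ₁ hκ₂)]
    have hDne : D ≠ 0 := hD0.ne'
    apply Complex.ext
    · simp only [Complex.add_re, Complex.mul_re, Complex.mul_im, Complex.neg_re, Complex.neg_im,
        Complex.ofReal_re, Complex.ofReal_im]
      simp only [sq, Complex.mul_re, Complex.mul_im, Complex.add_re, Complex.add_im, Complex.ofReal_re,
        Complex.ofReal_im, Complex.I_re, Complex.I_im, Complex.conj_re, Complex.conj_im]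
      field_simp
      rw [hD, hn₁, hn₂]
      ring
    · simp only [Complex.add_im, Complex.mul_re, Complex.mul_im, Complex.neg_re, Complex.neg_im,
        Complex.ofReal_re, Complex.ofReal_im]
      simp only [sq, Complex.mul_re, Complex.mul_im, Complex.add_re, Complex.add_im, Complex.ofReal_re,
        Complex.ofReal_im, Complex.I_re, Complex.I_im, Complex.conj_re, Complex.conj_im]
      field_simp
      rw [hD, hn₁, hn₂]
      ring
  · -- bound for m₁: D ≥ γ₂ (γ₁² - σ²) ≥ (3/4) γ₂ γ₁² and n₁ ≤ (3/2) γ₁²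
    have hD1 : γ₂ * (γ₁ ^ 2 - σ ^ 2) ≤ D := by
      rw [hD]; nlinarith [mul_pos hγ₁0 hg₂]
    have hs : σ ^ 2 ≤ γ₁ ^ 2 / 4 := by nlinarith
    have hn : n₁ ≤ 3 / 2 * γ₁ ^ 2 := by rw [hn₁]; linarith
    have hkey : c * γ₂ * n₁ ^ 2 ≤ 3 * c * γ₁ ^ 2 * D := by
      have e1 : n₁ ^ 2 ≤ (3 / 2 * γ₁ ^ 2) ^ 2 := pow_le_pow_left₀ hn₁0.le hn 2
      have e2 : 3 / 4 * γ₁ ^ 2 ≤ γ₁ ^ 2 - σ ^ 2 := by linarith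
      have e3 : γ₂ * (3 / 4 * γ₁ ^ 2) ≤ D := (mul_le_mul_of_nonneg_left e2 hγ₂0.le).trans hD1
      calc c * γ₂ * n₁ ^ 2 ≤ c * γ₂ * (3 / 2 * γ₁ ^ 2) ^ 2 := by
            exact mul_le_mul_of_nonneg_left e1 (by positivity)
        _ = 3 * c * γ₁ ^ 2 * (γ₂ * (3 / 4 * γ₁ ^ 2)) := by ring
        _ ≤ 3 * c * γ₁ ^ 2 * D := by
            exact mul_le_mul_of_nonneg_left e3 (by positivity)
    rw [div_le_iff₀ (by positivity), div_le_iff₀ hD0]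
    linarith
  · have hD2 : γ₁ * (γ₂ ^ 2 - σ ^ 2) ≤ D := by
      rw [hD]; nlinarith [mul_pos hγ₂0 hg₁]
    have hs : σ ^ 2 ≤ γ₂ ^ 2 / 4 := by nlinarith
    have hn : n₂ ≤ 3 / 2 * γ₂ ^ 2 := by rw [hn₂]; linarith
    have hkey : c * γ₁ * n₂ ^ 2 ≤ 3 * c * γ₂ ^ 2 * D := by
      have e1 : n₂ ^ 2 ≤ (3 / 2 * γ₂ ^ 2) ^ 2 := pow_le_pow_left₀ hn₂0.le hn 2
      have e2 : 3 / 4 * γ₂ ^ 2 ≤ γ₂ ^ 2 - σ ^ 2 := by linarith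
      have e3 : γ₁ * (3 / 4 * γ₂ ^ 2) ≤ D := (mul_le_mul_of_nonneg_left e2 hγ₁0.le).trans hD2
      calc c * γ₁ * n₂ ^ 2 ≤ c * γ₁ * (3 / 2 * γ₂ ^ 2) ^ 2 := by
            exact mul_le_mul_of_nonneg_left e1 (by positivity)
        _ = 3 * c * γ₂ ^ 2 * (γ₁ * (3 / 4 * γ₂ ^ 2)) := by ring
        _ ≤ 3 * c * γ₂ ^ 2 * D := by
            exact mul_le_mul_of_nonneg_left e3 (by positivity)
    rw [div_le_iff₀ (by positivity), div_le_iff₀ hD0]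
    linarith

/-! ## 2. The atoms as exponentials `e^{κ h}` -/

/-- `exp((log‖w‖/h + i(arg w + 2πN)/h)·h) = w`. -/
theorem exp_kappa₁ {w : ℂ} (hw : w ≠ 0) {h : ℝ} (hh : h ≠ 0) (N : ℕ) :
    Complex.exp ((((Real.log ‖w‖ / h : ℝ) : ℂ) + (((arg w + 2 * π * N) / h : ℝ) : ℂ) * I) * h) = w := by
  have hwpos : 0 < ‖w‖ := norm_pos_iff.mpr hw
  have : (((Real.log ‖w‖ / h : ℝ) : ℂ) + (((arg w + 2 * π * N) / h : ℝ) : ℂ) * I) * h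
      = (Real.log ‖w‖ : ℂ) + (arg w) * I + (N : ℂ) * (2 * π * I) := by
    have hh' : (h : ℂ) ≠ 0 := by exact_mod_cast hh
    push_cast
    field_simp
    ring
  rw [this, Complex.exp_add, Complex.exp_add, exp_nat_mul_two_pi_mul_I, mul_one, ← Complex.ofReal_exp,
    Real.exp_log hwpos, norm_mul_exp_arg_mul_I]

/-- `exp((log‖w‖/h + i(2πN − arg w)/h)·h) = conj w`. -/
theorem exp_kappa₂ {w : ℂ} (hw : w ≠ 0) {h : ℝ} (hh : h ≠ 0) (N : ℕ) :
    Complex.exp ((((Real.log ‖w‖ / h : ℝ) : ℂ) + (((2 * π * N - arg w) / h : ℝ) : ℂ) * I) * h)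
      = conj w := by
  have hwpos : 0 < ‖w‖ := norm_pos_iff.mpr hw
  have : (((Real.log ‖w‖ / h : ℝ) : ℂ) + (((2 * π * N - arg w) / h : ℝ) : ℂ) * I) * h
      = (Real.log ‖w‖ : ℂ) + conj ((arg w) * I) + (N : ℂ) * (2 * π * I) := by
    have hh' : (h : ℂ) ≠ 0 := by exact_mod_cast hh
    have hc : conj ((arg w : ℂ) * I) = -((arg w : ℂ) * I) := by
      rw [map_mul, Complex.conj_ofReal, Complex.conj_I]; ring
    rw [hc]
    push_cast
    field_simp
    ring
  rw [this, Complex.exp_add, Complex.exp_add, exp_nat_mul_two_pi_mul_I, mul_one, Complex.exp_conj,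
    ← Complex.ofReal_exp, Real.exp_log hwpos]
  have h1 : conj w = conj ((‖w‖ : ℂ) * Complex.exp (arg w * I)) := by rw [norm_mul_exp_arg_mul_I]
  rw [h1, map_mul, Complex.conj_ofReal]

/-! ## 3. The blind configuration -/

/-- **B16, kernel form.**  For every `h > 0` and `σ* > 0` there is a positive-real-weight configuration of
zero quadruples with abscissae in `(0, σ*)`, ordinates `> 14` and locally finite, `Σ m/γ² < ∞`, whose
supremum of abscissae is NOT attained, and whose model screw function has a uniform positive floor, is
bounded, and is positive semidefinite (`LPSD(h)`) on the lattice `hℕ`. -/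
theorem exists_blind_model {h σs : ℝ} (hh : 0 < h) (hσs : 0 < σs) :
    ∃ (ι : Type) (m₁ m₂ : ι → ℝ) (κ₁ κ₂ : ι → ℂ),
      Nonempty ι ∧
      (∀ i, 0 < m₁ i ∧ 0 < m₂ i) ∧
      (∀ i, 0 < (κ₁ i).re ∧ (κ₁ i).re < σs ∧ (κ₂ i).re = (κ₁ i).re) ∧
      (∀ i, 14 < (κ₁ i).im ∧ 14 < (κ₂ i).im) ∧
      (∀ T : ℝ, {i | (κ₁ i).im ≤ T}.Finite ∧ {i | (κ₂ i).im ≤ T}.Finite) ∧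
      Summable (fun i ↦ m₁ i / (κ₁ i).im ^ 2 + m₂ i / (κ₂ i).im ^ 2) ∧
      (∀ i, ∃ j, (κ₁ i).re < (κ₁ j).re) ∧
      (∃ A : ℝ, 0 < A ∧ ∀ k : ℕ, 1 ≤ k →
          2 * A ≤ modelPsi m₁ m₂ κ₁ κ₂ (k * h) ∧ modelPsi m₁ m₂ κ₁ κ₂ (k * h) ≤ 6 * A) ∧
      (∀ (N : ℕ) (t x : Fin N → ℝ), (∀ a, t a ∈ Set.range fun k : ℕ ↦ (k : ℝ) * h) →
          0 ≤ ∑ a, ∑ b, (modelPsi m₁ m₂ κ₁ κ₂ (t a) + modelPsi m₁ m₂ κ₁ κ₂ (t b)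
            - modelPsi m₁ m₂ κ₁ κ₂ (t a - t b)) * (x a * x b)) := by
  have hh0 : h ≠ 0 := hh.ne'
  -- Wolff packing data in the annulus `1 < |w| < e^{σ* h}`
  have hR : 1 < Real.exp (σs * h) := Real.one_lt_exp_iff.mpr (by positivity)
  obtain ⟨t, α, ht, hne, hts, hα0, hαs, hW, hsup⟩ := exists_wolffData hR
  haveI : Countable t := ht.to_subtype
  obtain ⟨f, hf⟩ := Countable.exists_injective_nat t
  -- aliases
  set N₀ : ℕ := ⌈(14 * h + 2 * σs * h + π) / (2 * π)⌉₊ + 1 with hN₀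
  have hN₀ge : (14 * h + 2 * σs * h + π) / (2 * π) + 1 ≤ (N₀ : ℝ) := by
    rw [hN₀]; push_cast; linarith [Nat.le_ceil ((14 * h + 2 * σs * h + π) / (2 * π))]
  set Nf : t → ℕ := fun i ↦ N₀ + f i with hNf
  -- the data
  set σ : t → ℝ := fun i ↦ Real.log ‖(i : ℂ)‖ / h with hσ_def
  set γ₁ : t → ℝ := fun i ↦ (arg (i : ℂ) + 2 * π * (Nf i : ℕ)) / h with hγ₁_def
  set γ₂ : t → ℝ := fun i ↦ (2 * π * (Nf i : ℕ) - arg (i : ℂ)) / h with hγ₂_def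
  set κ₁ : t → ℂ := fun i ↦ ((σ i : ℝ) : ℂ) + ((γ₁ i : ℝ) : ℂ) * I with hκ₁_def
  set κ₂ : t → ℂ := fun i ↦ ((σ i : ℝ) : ℂ) + ((γ₂ i : ℝ) : ℂ) * I with hκ₂_def
  -- elementary facts
  have hw0 : ∀ i : t, (i : ℂ) ≠ 0 := fun i ↦ by
    intro h0; have := (hts i i.2).1; rw [h0, norm_zero] at this; linarith
  have hσpos : ∀ i : t, 0 < σ i := fun i ↦ div_pos (Real.log_pos (hts i i.2).1) hh
  have hσlt : ∀ i : t, σ i < σs := fun i ↦ by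
    rw [hσ_def]
    simp only
    rw [div_lt_iff₀ hh]
    exact (Real.log_lt_iff_lt_exp (norm_pos_iff.mpr (hw0 i))).mpr (hts i i.2).2
  have hNlow : ∀ i : t, 14 * h + 2 * σs * h + π ≤ 2 * π * (Nf i : ℕ) - 2 * π := by
    intro i
    have h1 : (N₀ : ℝ) ≤ (Nf i : ℕ) := by rw [hNf]; push_cast; linarith [(f i).cast_nonneg (α := ℝ)]
    have h2 : (14 * h + 2 * σs * h + π) / (2 * π) ≤ (Nf i : ℕ) - 1 := by linarith
    rw [div_le_iff₀ (by positivity)] at h2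
    linarith
  have hγ₁low : ∀ i : t, 14 + 2 * σs < γ₁ i := by
    intro i
    rw [hγ₁_def]; simp only; rw [lt_div_iff₀ hh]
    linarith [hNlow i, Complex.neg_pi_lt_arg (i : ℂ), Real.pi_pos]
  have hγ₂low : ∀ i : t, 14 + 2 * σs < γ₂ i := by
    intro i
    rw [hγ₂_def]; simp only; rw [lt_div_iff₀ hh]
    linarith [hNlow i, Complex.arg_le_pi (i : ℂ), Real.pi_pos]
  -- tuning (λ = 1, c = α i)
  have htun : ∀ i : t, ∃ m₁ m₂ : ℝ, 0 < m₁ ∧ 0 < m₂ ∧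
      (m₁ : ℂ) / ((σ i : ℂ) + γ₁ i * I) ^ 2 + (m₂ : ℂ) / (conj ((σ i : ℂ) + γ₂ i * I)) ^ 2 = -(α i : ℂ) ∧
      m₁ / γ₁ i ^ 2 ≤ 3 * α i ∧ m₂ / γ₂ i ^ 2 ≤ 3 * α i := fun i ↦
    exists_tuning_bound (hσpos i) (by linarith [hσlt i, hγ₁low i]) (by linarith [hσlt i, hγ₂low i])
      (hα0 i i.2)
  choose m₁ m₂ hm₁ hm₂ htune hb₁ hb₂ using htun
  -- hypotheses of the model theorems
  have hw₁ : ∀ i : t, Complex.exp (κ₁ i * h) = (i : ℂ) := fun i ↦ exp_kappa₁ (hw0 i) hh0 (Nf i)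
  have hw₂ : ∀ i : t, Complex.exp (κ₂ i * h) = conj (i : ℂ) := fun i ↦ exp_kappa₂ (hw0 i) hh0 (Nf i)
  have htune' : ∀ i : t, (m₁ i : ℂ) / κ₁ i ^ 2 + (m₂ i : ℂ) / (conj (κ₂ i)) ^ 2
      = -(((1 : ℝ) * α i : ℝ) : ℂ) := by
    intro i; rw [one_mul]; exact htune i
  have hα0' : ∀ i : t, 0 ≤ α i := fun i ↦ (hα0 i i.2).le
  have hw1 : ∀ i : t, 1 ≤ ‖(i : ℂ)‖ := fun i ↦ (hts i i.2).1.le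
  refine ⟨t, m₁, m₂, κ₁, κ₂, hne.to_subtype, fun i ↦ ⟨hm₁ i, hm₂ i⟩, ?_, ?_, ?_, ?_, ?_, ?_, ?_⟩
  · intro i
    refine ⟨?_, ?_, ?_⟩
    · simpa [hκ₁_def] using hσpos i
    · simpa [hκ₁_def] using hσlt i
    · simp [hκ₁_def, hκ₂_def]
  · intro i
    constructor
    · simpa [hκ₁_def] using (by linarith [hγ₁low i] : 14 < γ₁ i)
    · simpa [hκ₂_def] using (by linarith [hγ₂low i] : 14 < γ₂ i)
  · -- local finiteness: `Im κ ≤ T` forces `f i ≤ ⌊…⌋`, and `f` is injective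
    intro T
    have key : ∀ i : t, (2 * π * (Nf i : ℕ) - π) / h ≤ T → f i ∈ Iic ⌈(T * h + π) / (2 * π)⌉₊ := by
      intro i hi
      rw [mem_Iic]
      rw [div_le_iff₀ hh] at hi
      have h1 : (f i : ℝ) ≤ (Nf i : ℕ) := by rw [hNf]; push_cast; linarith [(N₀).cast_nonneg (α := ℝ)]
      have h2 : (Nf i : ℝ) ≤ (T * h + π) / (2 * π) := by
        rw [le_div_iff₀ (by positivity)]; linarith
      exact_mod_cast (h1.trans h2).trans (Nat.le_ceil _)
    have hfin : (f ⁻¹' Iic ⌈(T * h + π) / (2 * π)⌉₊).Finite :=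
      (finite_Iic _).preimage hf.injOn
    constructor
    · refine hfin.subset fun i hi ↦ key i ?_
      have hi' : γ₁ i ≤ T := by simpa [hκ₁_def] using hi
      refine le_trans ?_ hi'
      rw [hγ₁_def]; simp only
      exact div_le_div_of_nonneg_right (by linarith [Complex.neg_pi_lt_arg (i : ℂ)]) hh.le
    · refine hfin.subset fun i hi ↦ key i ?_
      have hi' : γ₂ i ≤ T := by simpa [hκ₂_def] using hi
      refine le_trans ?_ hi'
      rw [hγ₂_def]; simp only
      exact div_le_div_of_nonneg_right (by linarith [Complex.arg_le_pi (i : ℂ)]) hh.le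
  · -- Σ m/γ² ≤ 6 Σ α
    have hs6 : Summable (fun i : t ↦ 6 * α i) := hαs.mul_left 6
    refine Summable.of_nonneg_of_le (fun i ↦ ?_) (fun i ↦ ?_) hs6
    · have := hm₁ i; have := hm₂ i
      simp only [hκ₁_def, hκ₂_def, Complex.add_im, Complex.ofReal_im, Complex.mul_im, Complex.ofReal_re,
        Complex.I_im, Complex.I_re, mul_one, mul_zero, zero_add, add_zero]
      positivity
    · simp only [hκ₁_def, hκ₂_def, Complex.add_im, Complex.ofReal_im, Complex.mul_im, Complex.ofReal_re,
        Complex.I_im, Complex.I_re, mul_one, mul_zero, zero_add, add_zero]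
      linarith [hb₁ i, hb₂ i]
  · -- sup not attained
    intro i
    obtain ⟨w', hw't, hlt⟩ := hsup i i.2
    refine ⟨⟨w', hw't⟩, ?_⟩
    simp only [hκ₁_def, Complex.add_re, Complex.ofReal_re, Complex.mul_re, Complex.I_re, Complex.I_im,
      Complex.ofReal_im, mul_zero, mul_one, sub_zero, add_zero, hσ_def]
    exact div_lt_div_of_pos_right (Real.log_lt_log (norm_pos_iff.mpr (hw0 i)) hlt) hh
  · -- floor and ceiling with A = Σ α > 0
    refine ⟨∑' i : t, α i, ?_, fun k hk ↦ ⟨?_, ?_⟩⟩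
    · obtain ⟨w, hw⟩ := hne
      exact hαs.tsum_pos (fun i ↦ hα0' i) ⟨w, hw⟩ (hα0 w hw)
    · have := modelPsi_lattice_floor hw₁ hw₂ htune' hαs hα0' hw1 zero_le_one hW hk
      simpa using this
    · have := modelPsi_lattice_ceiling hw₁ hw₂ htune' hαs hα0' hw1 zero_le_one hW hk
      simpa using this
  · intro N t' x ht'
    exact modelPsi_latticePSD hw₁ hw₂ htune' hαs hα0' hw1 zero_le_one hW t' x ht'

end Summit.RiemannHypothesis.RiemannHypothesis.Theorems.Splittings.ScrewLatticeWolffModel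

end
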